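import Literature.AlgebraicGeometry.Motives.AbelianVarietyVerschiebung
import Literature.AlgebraicGeometry.Motives.AbelianVarietyGoodReductionFrobenius
import HarnessLib

/-!
# The Verschiebung of the reduction of an abelian variety with good reduction: `V * π = N v = π * V`

Topic `Literature/AlgebraicGeometry/Motives`, namespace `Literature.AlgebraicGeometry.Motives.AbelianVariety.GoodReductionAt`.
THEOREMS ONLY (no definition, no named fact, no instance; net Literature debt **0**).  Cell `hodgecm-mathlib`
(D-0151), FLOOR-0 P5a (D9op road 2′): the «(Ver)» hypothesis `hV : V * End.of (frobeniusHom R.reduction) = (q : End R.reduction)`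
of ★ `GoodReductionAt.pinned_eichlerShimura_of_honest` (`Motives/AbelianVarietyEichlerShimuraPinTransport`) with the
`q` OF THE REGISTERED LETTER, `q := Ideal.absNorm v.asIdeal` (`RecordCurveEichlerShimuraModel` of
`Cruxes/HLiu418/Lines/F0_D9opRoad2.lean`), DISCHARGED for every good-reduction datum `R`:

* `exists_verschiebung_absNorm` — for `R : A₀.GoodReductionAt v` there is `V ∈ End Ā` (`Ā = R.reduction`, an
  abelian variety over the residue field `κ(v)`) with `V * π = N v` and `π * V = N v`, `π = frobeniusHom Ā` the
  `#κ(v)`-power Frobenius and `N v = Ideal.absNorm v.asIdeal = #κ(v)` (★ `natCard_residueField`,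
  `residueCard = Ideal.absNorm` by `rfl`); this is ★ `AbelianVariety.exists_verschiebung` read at `Ā`
  ([EdixhovenVanDerGeerMoonenAV] Ch. 5 §2; [Milne1986AbelianVarieties] §19 Lemma 19.2 «`π† ∘ π = q`»;
  [Shimura1998] §19.4 «`φ_𝔭` the `N(𝔭)`-th power endomorphism of `Ã`»).
* `verschiebung_unique_absNorm` — such a `V` is UNIQUE (`π` is an epimorphism: ★
  `existsUnique_frobeniusHom_comp_eq_card_zsmul_id`), so the pole may identify ITS geometric Verschiebung
  (the Albanese trace of the `q`-Frobenius of the special fibre) with this one.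

HC_CM is proved only modulo the printed citations until rung 0 closes; this file adds no hypothesis.

## References
* [EdixhovenVanDerGeerMoonenAV] B. Edixhoven, G. van der Geer, B. Moonen, *Abelian Varieties* (book draft), Ch. 5 §2.
* [Milne1986AbelianVarieties] J. S. Milne, *Abelian Varieties* (Cornell–Silverman 1986), §19 Lemma 19.2 (p. 145).
* [Shimura1998] G. Shimura, *Abelian Varieties with Complex Multiplication and Modular Functions* (1998), §19.4 (p. 133).
* [Liu2021] Y. Liu, *Fourier–Jacobi cycles and arithmetic relative trace formula*, Camb. J. Math. 9 (2021), App. D,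
  proof of Cor. D.9 (p. 139).
-/

set_option autoImplicit false

noncomputable section

open CategoryTheory IsDedekindDomain
open scoped NumberField

namespace Literature.AlgebraicGeometry.Motives

namespace AbelianVariety

namespace GoodReductionAt

variable {K : Type} [Field K] [NumberField K] {A₀ : AbelianVariety K} {v : HeightOneSpectrum (𝓞 K)}
  (R : A₀.GoodReductionAt v)

/-- `#κ(v) = N v` (`Nat.card v.asIdeal.ResidueField = Ideal.absNorm v.asIdeal`): ★ `natCard_residueField` and
`residueCard = Ideal.absNorm` (`rfl`). [folklore] -/
private theorem natCard_residueField_eq_absNorm (v : HeightOneSpectrum (𝓞 K)) :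
    Nat.card v.asIdeal.ResidueField = Ideal.absNorm v.asIdeal :=
  natCard_residueField v

/-- **The Verschiebung of the reduction, `q = N v`:** for a good-reduction datum `R` of `A₀` at `v` there is
`V ∈ End Ā` (`Ā = R.reduction`) with `V * π = N v` and `π * V = N v` in `End Ā` (`π = End.of (frobeniusHom Ā)` the
`#κ(v)`-power Frobenius endomorphism, `N v = Ideal.absNorm v.asIdeal`, Mathlib's `f * g = g ≫ f`) — the «(Ver)»
hypothesis of ★ `pinned_eichlerShimura_of_honest` at the registered `q`.
[cite: EdixhovenVanDerGeerMoonenAV, Ch. 5 §2 (Verschiebung, `V ∘ F = [p]`)] [cite: Milne1986AbelianVarieties, §19 Lemma 19.2 (p. 145)]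
[cite: Shimura1998, §19.4 (p. 133)] -/
theorem exists_verschiebung_absNorm :
    ∃ V : End R.reduction, V * End.of (frobeniusHom R.reduction) = (Ideal.absNorm v.asIdeal : End R.reduction) ∧
      End.of (frobeniusHom R.reduction) * V = (Ideal.absNorm v.asIdeal : End R.reduction) := by
  rw [← natCard_residueField_eq_absNorm v]
  exact R.reduction.exists_verschiebung

/-- **Uniqueness of the Verschiebung of the reduction:** two endomorphisms `V, V'` of `Ā` with `V * π = N v = V' * π`
coincide (`π` is an epimorphism; ★ `existsUnique_frobeniusHom_comp_eq_card_zsmul_id`).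
[cite: EdixhovenVanDerGeerMoonenAV, Ch. 5 §2 (Verschiebung, `V ∘ F = [p]`)] [cite: Milne1986AbelianVarieties, §19 Lemma 19.2 (p. 145)] -/
theorem verschiebung_unique_absNorm {V V' : End R.reduction}
    (hV : V * End.of (frobeniusHom R.reduction) = (Ideal.absNorm v.asIdeal : End R.reduction))
    (hV' : V' * End.of (frobeniusHom R.reduction) = (Ideal.absNorm v.asIdeal : End R.reduction)) : V = V' := by
  obtain ⟨W, -, huniq⟩ := R.reduction.existsUnique_frobeniusHom_comp_eq_card_zsmul_id
  have hq : ((Ideal.absNorm v.asIdeal : End R.reduction) : R.reduction ⟶ R.reduction) =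
      ((Nat.card v.asIdeal.ResidueField : ℤ) • 𝟙 R.reduction : R.reduction ⟶ R.reduction) := by
    rw [natCard_residueField_eq_absNorm v, natCast_zsmul, ← Nat.smul_one_eq_cast, End.one_def]
    rfl
  have h1 : frobeniusHom R.reduction ≫ V = (Nat.card v.asIdeal.ResidueField : ℤ) • 𝟙 R.reduction := by
    rw [← hq, ← hV, End.mul_def]
  have h2 : frobeniusHom R.reduction ≫ V' = (Nat.card v.asIdeal.ResidueField : ℤ) • 𝟙 R.reduction := by
    rw [← hq, ← hV', End.mul_def]
  exact (huniq V h1).trans (huniq V' h2).symm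

end GoodReductionAt

end AbelianVariety

end Literature.AlgebraicGeometry.Motives

end
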